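import Summits.MatrixMultiplication.OmegaCensus.ThreeSetLineInverseCertificate
import Summits.MatrixMultiplication.OmegaCensus.DominoZpZpScaled
import HarnessLib

/-!
# Kernel computation for `(4,4,6)@289`: W-killer `3` = `[0,0,0,0,0,0,0,0,0,0,0,0,1,1,0,0,2]`, chunks `39–41` of `48`

ω-census `pub-omega`, family (b3), seat pub-omega-group gen 39.  Framing: lottery ticket; floor = certified bounds/negative ranges.
VALUE: part of the kernel certificate that the three-set line datum `W = [0,0,0,0,0,0,0,0,0,0,0,0,1,1,0,0,2]` (count vector on `ℤ₁₇`) admits NO `(X, Y, s)`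
solving the three-set line identity at fibre size `17` with `|X| = 4`, `|Y| = 6` — for the `X`-data in chunks of `101` of
`ZpZpDomino.compsLit 17 4` (all `4845` count vectors of mass `4`), by the in-kernel inverse certificate `LineInv.noSol3Chk`
(`ThreeSetLineInverseCertificate`; prime `103` with `ζ = 64`, fallback `137` with `ζ = 119`).  Joined in `ThreeSetZ17Killers446Join`;
used by the cell theorem for `(4,4,6)@289` (`Dih(ℤ₁₇²)`).  NOT progress on ω.
-/

namespace Summit.MatrixMultiplication.OmegaCensus

namespace Z17Killers446

/-- Chunk `39` of killer `3`: the `X`-data `compsLit 17 4 [101·39, 101·39+101)` are refuted (`N = 103`, else `N = 137`). [folklore] -/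
theorem kill446_k3_c39 : ((((ZpZpDomino.compsLit 17 4).drop (101 * 39)).take 101).all fun F =>
    LineInv.noSol3Chk 17 103 64 17 6 [0,0,0,0,0,0,0,0,0,0,0,0,1,1,0,0,2] F || LineInv.noSol3Chk 17 137 119 17 6 [0,0,0,0,0,0,0,0,0,0,0,0,1,1,0,0,2] F) = true := by
  decide +kernel

/-- Chunk `40` of killer `3`: the `X`-data `compsLit 17 4 [101·40, 101·40+101)` are refuted (`N = 103`, else `N = 137`). [folklore] -/
theorem kill446_k3_c40 : ((((ZpZpDomino.compsLit 17 4).drop (101 * 40)).take 101).all fun F =>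
    LineInv.noSol3Chk 17 103 64 17 6 [0,0,0,0,0,0,0,0,0,0,0,0,1,1,0,0,2] F || LineInv.noSol3Chk 17 137 119 17 6 [0,0,0,0,0,0,0,0,0,0,0,0,1,1,0,0,2] F) = true := by
  decide +kernel

/-- Chunk `41` of killer `3`: the `X`-data `compsLit 17 4 [101·41, 101·41+101)` are refuted (`N = 103`, else `N = 137`). [folklore] -/
theorem kill446_k3_c41 : ((((ZpZpDomino.compsLit 17 4).drop (101 * 41)).take 101).all fun F =>
    LineInv.noSol3Chk 17 103 64 17 6 [0,0,0,0,0,0,0,0,0,0,0,0,1,1,0,0,2] F || LineInv.noSol3Chk 17 137 119 17 6 [0,0,0,0,0,0,0,0,0,0,0,0,1,1,0,0,2] F) = true := by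
  decide +kernel

end Z17Killers446

end Summit.MatrixMultiplication.OmegaCensus
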